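import Summits.ValiantsHypothesis.ValiantsHypothesis.Theorems.SymPencilPerFourTwoRowsClawMatching
import Summits.ValiantsHypothesis.ValiantsHypothesis.Theorems.SymPencilPerFourTwoRowCorankTwo
import Summits.ValiantsHypothesis.ValiantsHypothesis.Theorems.SymPencilSingSixClassificationDefs

/-!
# Route `SymPencil` — Lemma TwoRows and leaf R2 of the `(11, 5, 4)` cascade: two zero rows, `dim W = 5`,
# per-direction family of four squares ⇒ the live rows have a common zero column
# (`--supports` stmt-ValiantsHypothesis-5674 `SdcSuperquadratic`; port of `stub_twoZeroRows` of
# `Cruxes/SdcSuperquadratic/Lines/sing_five_classification.lean` (val-idea-18 g5 rev 4), memo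
# `SING-FIVE-CLASSIFICATION.md` §1 (I4), §4; rung currency only)

* `common_zero_coord` — **Lemma TwoRows, abstract form (I4)**: `U ⊆ K⁴ × K⁴`, `dim U ≥ 5`, every element STAR
  or BIPARTITE for the six forms `α_i β_j + α_j β_i` (verbatim the conclusion of
  `SymPencilPerFourTwoRowCorankTwo.star_or_bipartite_of_sum_sq_swap_rows01`) ⇒ some coordinate `m` has
  `α_m ≡ β_m ≡ 0` on `U`.  A generic element of `U` (`exists_forall_quad_ne_zero`) is a common non-zero of the
  forms not vanishing identically, so its star / matching consists of forms vanishing IDENTICALLY; then `claw` /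
  `finrank_le_four_of_matching`.  (Stated abstractly because leaf R1N reuses it on the two-row projections
  `W_{rs}`.)
* `twoZeroRows_common_zero_column` — **leaf R2** = the workfile's `stub_twoZeroRows` with its local predicates
  `PerDirFour` / `InWCol` UNFOLDED (`TwoZeroRows` by its tree name): pointwise the live rows `p, q` are star or
  bipartite (`star_or_bipartite_of_sum_sq_swap_rows`, `4 < 6` squares, reused by name), and `W` maps injectively to
  `K⁴ × K⁴` by `(rowL p, rowL q)`.

Wiring for a 5674 crux-write hand: `theorem stub_twoZeroRows … := SymPencilPerFourTwoRowsCommonZeroColumn.twoZeroRows_common_zero_column`.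
Honest framing: [folklore]; ONE leaf (R2) of the `(11,5,4)` cascade — leaves R1C, R1N and the cell file remain OPEN;
`27 ≤ sdc(per₄) ≤ 29` unchanged; the crux `SdcSuperquadratic` and `VP ≠ VNP` untouched; no summit statement is proved
here.  No definitions, no named facts.
-/

noncomputable section

-- single-conjunct layout: Sub = Summit, duplicated namespace component intended
set_option linter.dupNamespace false

namespace Summit.ValiantsHypothesis.ValiantsHypothesis.Theorems.SymPencilPerFourTwoRowsCommonZeroColumn

open Module Matrix MvPolynomial
open Literature.Computability.AlgebraicComplexity
open Summit.ValiantsHypothesis.ValiantsHypothesis.Theorems.SymPencilPerFourTwoRowsClawMatching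
open Summit.ValiantsHypothesis.ValiantsHypothesis.Theorems.SymPencilPerFourTwoRowCorankTwo
open Summit.ValiantsHypothesis.ValiantsHypothesis.Theorems.SymPencilSingSixClassification

variable {K : Type*} [Field K]

/-- **Lemma TwoRows (abstract form; memo SING-FIVE-CLASSIFICATION §1 (I4)).**  Let `U ⊆ K⁴ × K⁴` have
dimension `≥ 5` and suppose every `(α, β) ∈ U` is STAR or BIPARTITE for the six forms
`m_{ij} = α_i β_j + α_j β_i` (the conclusion of `star_or_bipartite_of_sum_sq_swap_rows01`).  Then
some coordinate `m` has `α_m = β_m = 0` on all of `U`.  Proof: a generic element of `U`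
(`exists_forall_quad_ne_zero`) is a common non-zero of all `m_{ij}` that do not vanish identically on
`U`, so its star (resp. matching) consists of forms vanishing IDENTICALLY on `U`; a claw gives the zero
coordinate (`claw`), a matching contradicts `dim U ≥ 5` (`finrank_le_four_of_matching`). [folklore] -/
theorem common_zero_coord [CharZero K] (U : Submodule K ((Fin 4 → K) × (Fin 4 → K)))
    (h5 : 5 ≤ finrank K U)
    (hSB : ∀ y ∈ U,
      ((y.1 0 * y.2 1 + y.1 1 * y.2 0 = 0 ∧ y.1 0 * y.2 2 + y.1 2 * y.2 0 = 0 ∧ y.1 0 * y.2 3 + y.1 3 * y.2 0 = 0) ∨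
        (y.1 0 * y.2 1 + y.1 1 * y.2 0 = 0 ∧ y.1 1 * y.2 2 + y.1 2 * y.2 1 = 0 ∧ y.1 1 * y.2 3 + y.1 3 * y.2 1 = 0) ∨
        (y.1 0 * y.2 2 + y.1 2 * y.2 0 = 0 ∧ y.1 1 * y.2 2 + y.1 2 * y.2 1 = 0 ∧ y.1 2 * y.2 3 + y.1 3 * y.2 2 = 0) ∨
        (y.1 0 * y.2 3 + y.1 3 * y.2 0 = 0 ∧ y.1 1 * y.2 3 + y.1 3 * y.2 1 = 0 ∧ y.1 2 * y.2 3 + y.1 3 * y.2 2 = 0)) ∨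
      ((y.1 0 * y.2 1 + y.1 1 * y.2 0 = 0 ∧ y.1 2 * y.2 3 + y.1 3 * y.2 2 = 0 ∧
          (y.1 0 * y.2 2 + y.1 2 * y.2 0) * (y.1 1 * y.2 3 + y.1 3 * y.2 1) =
            (y.1 0 * y.2 3 + y.1 3 * y.2 0) * (y.1 1 * y.2 2 + y.1 2 * y.2 1)) ∨
        (y.1 0 * y.2 2 + y.1 2 * y.2 0 = 0 ∧ y.1 1 * y.2 3 + y.1 3 * y.2 1 = 0 ∧
          (y.1 0 * y.2 1 + y.1 1 * y.2 0) * (y.1 2 * y.2 3 + y.1 3 * y.2 2) =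
            (y.1 0 * y.2 3 + y.1 3 * y.2 0) * (y.1 1 * y.2 2 + y.1 2 * y.2 1)) ∨
        (y.1 0 * y.2 3 + y.1 3 * y.2 0 = 0 ∧ y.1 1 * y.2 2 + y.1 2 * y.2 1 = 0 ∧
          (y.1 0 * y.2 1 + y.1 1 * y.2 0) * (y.1 2 * y.2 3 + y.1 3 * y.2 2) =
            (y.1 0 * y.2 2 + y.1 2 * y.2 0) * (y.1 1 * y.2 3 + y.1 3 * y.2 1)))) :
    ∃ m : Fin 4, ∀ y ∈ U, y.1 m = 0 ∧ y.2 m = 0 := by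
  classical
  -- the six forms and a generic element of `U`
  let x : Fin 4 → Fin 4 → ((Fin 4 → K) × (Fin 4 → K)) → K := fun k m y => y.1 k * y.2 m + y.1 m * y.2 k
  have hquad : ∀ (e : Fin 4 × Fin 4) (y y' : (Fin 4 → K) × (Fin 4 → K)), ∃ B : K, ∀ t : K,
      x e.1 e.2 (y + t • y') = x e.1 e.2 y + t * B + t ^ 2 * x e.1 e.2 y' := fun e y y' =>
    ⟨y.1 e.1 * y'.2 e.2 + y'.1 e.1 * y.2 e.2 + y.1 e.2 * y'.2 e.1 + y'.1 e.2 * y.2 e.1, fun t => by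
      simp only [x, Prod.fst_add, Prod.snd_add, Prod.smul_fst, Prod.smul_snd, Pi.add_apply, Pi.smul_apply,
        smul_eq_mul]
      ring⟩
  let T : Finset (Fin 4 × Fin 4) := Finset.univ.filter fun e => ∃ y ∈ U, x e.1 e.2 y ≠ 0
  obtain ⟨z, hzU, hz⟩ := exists_forall_quad_ne_zero U T (fun e => x e.1 e.2) hquad
    (fun e he => by simpa [T] using he)
  have unif : ∀ k m, x k m z = 0 → ∀ y ∈ U, x k m y = 0 := by
    intro k m h0 y hy
    by_contra hne
    exact hz (k, m) (by simp only [T, Finset.mem_filter, Finset.mem_univ, true_and]; exact ⟨y, hy, hne⟩) h0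
  have unif' : ∀ k m, x k m z = 0 → ∀ y ∈ U, x k m y = 0 ∧ x m k y = 0 := fun k m h0 y hy =>
    ⟨unif k m h0 y hy, by rw [show x m k y = x k m y from add_comm _ _]; exact unif k m h0 y hy⟩
  rcases hSB z hzU with (hS | hS | hS | hS) | (hB | hB | hB)
  · refine ⟨0, claw U h5 0 fun y hy j hj => ?_⟩
    change x 0 j y = 0
    fin_cases j
    · exact (hj rfl).elim
    · exact (unif' 0 1 hS.1 y hy).1
    · exact (unif' 0 2 hS.2.1 y hy).1
    · exact (unif' 0 3 hS.2.2 y hy).1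
  · refine ⟨1, claw U h5 1 fun y hy j hj => ?_⟩
    change x 1 j y = 0
    fin_cases j
    · exact (unif' 0 1 hS.1 y hy).2
    · exact (hj rfl).elim
    · exact (unif' 1 2 hS.2.1 y hy).1
    · exact (unif' 1 3 hS.2.2 y hy).1
  · refine ⟨2, claw U h5 2 fun y hy j hj => ?_⟩
    change x 2 j y = 0
    fin_cases j
    · exact (unif' 0 2 hS.1 y hy).2
    · exact (unif' 1 2 hS.2.1 y hy).2
    · exact (hj rfl).elim
    · exact (unif' 2 3 hS.2.2 y hy).1
  · refine ⟨3, claw U h5 3 fun y hy j hj => ?_⟩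
    change x 3 j y = 0
    fin_cases j
    · exact (unif' 0 3 hS.1 y hy).2
    · exact (unif' 1 3 hS.2.1 y hy).2
    · exact (unif' 2 3 hS.2.2 y hy).2
    · exact (hj rfl).elim
  · have := finrank_le_four_of_matching U 0 1 2 3 (by decide)
      (fun y hy => unif 0 1 hB.1 y hy) (fun y hy => unif 2 3 hB.2.1 y hy)
    omega
  · have := finrank_le_four_of_matching U 0 2 1 3 (by decide)
      (fun y hy => unif 0 2 hB.1 y hy) (fun y hy => unif 1 3 hB.2.1 y hy)
    omega
  · have := finrank_le_four_of_matching U 0 3 1 2 (by decide)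
      (fun y hy => unif 0 3 hB.1 y hy) (fun y hy => unif 1 2 hB.2.1 y hy)
    omega

/-- The two indices complementary to a pair `p' ≠ q'` in `Fin 4`. [folklore] -/
theorem exists_compl_pair : ∀ p' q' : Fin 4, p' ≠ q' →
    ∃ p q : Fin 4, p ≠ q ∧ p ≠ p' ∧ p ≠ q' ∧ q ≠ p' ∧ q ≠ q' ∧ ∀ i : Fin 4, i = p ∨ i = q ∨ i = p' ∨ i = q' := by
  decide

/-- **Leaf R2 of the `(11,5,4)` cascade (`stub_twoZeroRows` of
`Cruxes/SdcSuperquadratic/Lines/sing_five_classification.lean`, with the workfile predicates `PerDirFour` and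
`InWCol` UNFOLDED): two zero rows, `dim W = 5`, per-direction family of four squares ⇒ the two live
rows have a common zero column.**  Pointwise the live rows are STAR or BIPARTITE
(`star_or_bipartite_of_sum_sq_swap_rows`, `4 < 6` squares); Lemma TwoRows (`common_zero_coord`) on the
image of `W` in `K⁴ × K⁴` under the two live-row projections (injective on `W`). [folklore] -/
theorem twoZeroRows_common_zero_column [CharZero K] :
    ∀ W : Submodule K (Fin 4 × Fin 4 → K), finrank K W = 5 → TwoZeroRows W →
      (∀ y ∈ W, ∃ (c : Fin 4 → K) (Λ : Fin 4 → ((Fin 4 × Fin 4 → K) →ₗ[K] K)),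
        ∀ u : Fin 4 × Fin 4 → K, ∃ e₀ e₁ : K, ∀ s : K,
          eval (u + s • y) (perPoly (Fin 4) K) = e₀ + s * e₁ + s ^ 2 * ∑ k, c k * (Λ k u) ^ 2) →
      ∃ p q m : Fin 4, p ≠ q ∧
        ∀ x ∈ W, (∀ i j : Fin 4, i ≠ p → i ≠ q → x (i, j) = 0) ∧ x (p, m) = 0 ∧ x (q, m) = 0 := by
  intro W h5 hT hP
  obtain ⟨p', q', hp'q', hzero⟩ := hT
  obtain ⟨p, q, hpq, hpp', hpq', hqp', hqq', hcov⟩ := exists_compl_pair p' q' hp'q'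
  have hy0 : ∀ x ∈ W, ∀ i j : Fin 4, i ≠ p → i ≠ q → x (i, j) = 0 := by
    intro x hx i j hip hiq
    rcases hcov i with h | h | h | h
    · exact absurd h hip
    · exact absurd h hiq
    · rw [h]; exact (hzero x hx j).1
    · rw [h]; exact (hzero x hx j).2
  -- the two live rows, as a map to `K⁴ × K⁴`, injective on `W`
  let R : (Fin 4 × Fin 4 → K) →ₗ[K] ((Fin 4 → K) × (Fin 4 → K)) := (rowL p).prod (rowL q)
  have hR : ∀ x : Fin 4 × Fin 4 → K, R x = (fun j => x (p, j), fun j => x (q, j)) := fun x => rfl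
  have hker : LinearMap.ker (R.comp W.subtype) = ⊥ := by
    refine LinearMap.ker_eq_bot'.2 ?_
    rintro ⟨x, hx⟩ h0
    have h0' : R x = 0 := h0
    rw [hR] at h0'
    have hp0 : ∀ j, x (p, j) = 0 := fun j => by simpa using congrFun (congrArg Prod.fst h0') j
    have hq0 : ∀ j, x (q, j) = 0 := fun j => by simpa using congrFun (congrArg Prod.snd h0') j
    apply Subtype.ext
    funext ⟨i, j⟩
    rcases hcov i with h | h | h | h
    · rw [h]; exact hp0 j
    · rw [h]; exact hq0 j
    · rw [h]; exact (hzero x hx j).1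
    · rw [h]; exact (hzero x hx j).2
  have hU5 : 5 ≤ finrank K (W.map R) := by
    have h1 := LinearMap.finrank_range_add_finrank_ker (R.comp W.subtype)
    rw [hker, finrank_bot, add_zero, LinearMap.range_comp, Submodule.range_subtype] at h1
    rw [h1, h5]
  -- pointwise star-or-bipartite on the image
  obtain ⟨m, hm⟩ := common_zero_coord (W.map R) hU5 (by
    rintro _ ⟨y, hy, rfl⟩
    obtain ⟨c, Λ, h⟩ := hP y hy
    have key := star_or_bipartite_of_sum_sq_swap_rows (ι := Fin 4) (by simp) hpq y (hy0 y hy) c Λ h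
    rw [hR]
    exact key)
  refine ⟨p, q, m, hpq, fun x hx => ⟨hy0 x hx, ?_, ?_⟩⟩
  · have := (hm (R x) ⟨x, hx, rfl⟩).1
    rw [hR] at this; exact this
  · have := (hm (R x) ⟨x, hx, rfl⟩).2
    rw [hR] at this; exact this

end Summit.ValiantsHypothesis.ValiantsHypothesis.Theorems.SymPencilPerFourTwoRowsCommonZeroColumn

end
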